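import Summits.AtomisticToContinuum.Crystallization.Theorems.ChartedZeroExcessLayeredLatticeLiouvilleZZC
import Mathlib.Geometry.Euclidean.Angle.Unoriented.TriangleInequality

/-!
# Part ZZD «ConeLemma» (lens-2 g80; the tree's CLOSURE of the g79 record alert on (L2-S), critic row 1440 (A))

Rider ZZC typed the NEGATIVE half of the pinning step (L2-S): an ISOLATED zone `P`-site (no Barlow neighbour inside the coordinate region `R`)
kills `IsPinningDatum` (`not_isPinningDatum_of_isolated`), and cavity containers (`K = S ∩ (B̄(x₀,12) ∖ B̄(x₀,4))`, container radius ABOVE the zone's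
inner radius) produce such sites.  This rider proves that AT THE RECORD DIALS — container radius `q = 4` (`∀ k ∈ K, dist k x₀ ≤ 4`), zone inner radius
`r = 8`, `P`-radius `Rp = 57/4`, `R`-radius `R₁ = 82/5`, moat width `ℓ = 43/2`, `aHi = 1` — NO zone `P`-site is isolated: the hypothesis `hiso` of
`not_isPinningDatum_of_isolated` has no instance at the record (`exists_barlowAdj_zoneCoords_record`), so ZZC's mechanism does not touch (L2-S) as
typed; it is the negative half of a future iff in the regime `q ≳ r` only (critic row 1440 (A)).  The intended regime of the generic-dial pieces
(L2-S) `DoorChartPinningP` / (GL) `BondLabelP` is `r ≥ 2q`.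

* §1 ★ THE CONE LEMMA (pure Euclidean geometry, any real inner product space): if `K ⊆ B̄(x₀, q)`, `dist y p ≥ r ≥ 2q` for `y ∈ K`, then every
  `y ∈ K` is seen from `p` within `30°` of the direction `x₀ − p` (`sin ∠ ≤ q/r ≤ 1/2`); hence a step `n − p` making an angle `≥ 120°` with
  `x₀ − p` (`⟪n − p, x₀ − p⟫ ≤ −½‖n − p‖‖x₀ − p‖`) has `⟪n − p, y − p⟫ ≤ 0` and `dist n y > r`: `inner_nonpos_of_cone`, `lt_dist_of_cone`
  (Mathlib's angle triangle inequality `InnerProductGeometry.angle_le_angle_add_angle`).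
* §2 COVERING RADIUS `45°` OF BOTH KISSING PATTERNS: every direction `w` is within `45°` of a first-shell vector of the fcc AND of the hcp
  two-shell pattern (`exists_kissing_toward`: `‖w‖ ≤ √2·⟪v, w⟫`, `‖v‖ = 1`).  fcc: signs on the two largest `|coordinates|`; hcp: the same
  selection lands in the hexagon ∪ upper cap when `Σ w ≥ 0`, and for `Σ w < 0` it is applied to the MIRROR image `w − (2/3)(Σ w)·(1,1,1)`
  (lower cap = mirrored upper cap).  Memberships by `decide`.
* §3 from two-shell cleanliness `IsTwoShellGoodSet (1/16) (9/10) aHi S p`: toward ANY direction `w ≠ 0` there is an atom `n ∈ S` with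
  `0 < dist n p ≤ 17/16·aHi` and `∠(n − p, w) ≤ 60°` (`exists_atom_toward`; `√2/2 − 1/16 ≥ 17/32`).
* §4 ★ `exists_zone_neighbour_of_container` (symbolic dials `2q ≤ r`, `0 < r`, `ρ + 17/16·aHi + q < ℓ`, `17/16·aHi ≤ 28/25`): a clean moat atom
  `p ∈ moatIn S K r ℓ` with `dist p x₀ ≤ ρ` has a BOND neighbour `n ∈ moatIn S K r ℓ` with `dist n x₀ ≤ ρ + 17/16·aHi` — the step AWAY from `x₀`.
* §5 the record corollaries: `exists_zone_neighbour_record` (dials `(q, r, ρ, ℓ, aHi) = (4, 8, 57/4, 43/2, 1)`, landing radius `≤ 82/5`) and, through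
  a global Barlow bond chart, `exists_barlowAdj_zoneCoords_record`: every `x ∈ zoneCoords Ψ S K 8 (43/2) (57/4) x₀` has a Barlow neighbour in
  `zoneCoords Ψ S K 8 (43/2) (82/5) x₀` — the negation of ZZC's `hiso` at the record: `not_isolated_zoneCoords_record`.
* §6 shadow: the cavity dials `(q, r) = (12, 4)` of the ZZC instance violate `2q ≤ r` (`cavity_dials_outside_cone_regime`).

0 sorry; standard axioms.  Design note for (B′) (critic row 1440 (A)(ii)): the outward gain per bond step guaranteed here is `17/16·aHi` in RADIUS
budget but only `≥ 0` in distance from `K`; reach at the inner zone boundary is a design constraint of the (T)-endgame, not a hygiene fix.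
-/

noncomputable section
open scoped BigOperators Classical InnerProductSpace RealInnerProductSpace
open MeasureTheory Set Metric Filter Topology
open Summit.AtomisticToContinuum.Crystallization.Theorems.ChartedPlanarOrderRigidityDoor (E3 IsClean IsCharted)
open Summit.AtomisticToContinuum.Crystallization.Theorems.ChartedPlanarOrderDensityDichotomy (μS IsSep)
open Summit.AtomisticToContinuum.Crystallization.Theorems.ChartedPlanarOrderCleanScaleP (IsCleanP IsDoorSetP isCleanP_one_iff isCleanP_μS_iff)
open Summit.AtomisticToContinuum.Crystallization.Theorems.ChartedPlanarOrderMesoCut (LayeredHom EnvClose)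
open Summit.AtomisticToContinuum.Crystallization.Theorems.ChartedPlanarOrderDoorLayeredOsc (IsTwoShellAffineGood mem_iff_μS_singleton_ne_zero)
open Literature.MathematicalPhysics.StatisticalMechanics (lennardJones triangularVec₁ triangularVec₂)
open Literature.Geometry.DiscreteGeometry (IsTwoShellGoodSet intVec intVec_apply fccInt hcpInt fccKissingPattern hcpKissingPattern scaledPattern
  fccTwoShellPattern hcpTwoShellPattern fccKissingPattern_subset hcpKissingPattern_subset norm_eq_one_of_mem_fccKissingPattern
  norm_eq_one_of_mem_hcpKissingPattern)

namespace Summit.AtomisticToContinuum.Crystallization.Theorems.ChartedZeroExcessLayeredLatticeLiouville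

/-! ### §1  The cone lemma -/

section Cone

variable {V : Type*} [NormedAddCommGroup V] [InnerProductSpace ℝ V]

open InnerProductGeometry

/-- ★ **THE CONE LEMMA (vector form).**  `‖v − u‖ ≤ q`, `‖v‖ ≥ r ≥ 2q` (the target `v` lies in the `30°`-cone around `u`) and
`⟪b, u⟫ ≤ −½‖b‖‖u‖` (the step `b` makes an angle `≥ 120°` with `u`) give `⟪b, v⟫ ≤ 0`.  Spherical triangle inequality at the apex
(`InnerProductGeometry.angle_le_angle_add_angle`) and `cos (120° − 30°) = 0`. [this file, g80] -/
theorem inner_nonpos_of_cone_vec {b u v : V} {q r : ℝ} (hqr : 2 * q ≤ r) (hvu : ‖v - u‖ ≤ q) (hrv : r ≤ ‖v‖)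
    (hn : ⟪b, u⟫_ℝ ≤ -(1 / 2) * (‖b‖ * ‖u‖)) : ⟪b, v⟫_ℝ ≤ 0 := by
  have hq0 : 0 ≤ q := (norm_nonneg _).trans hvu
  -- (1) `⟪v, u⟫ ≥ 0`
  have hvvu : ⟪v, v - u⟫_ℝ ≤ ‖v‖ * q := (real_inner_le_norm _ _).trans (mul_le_mul_of_nonneg_left hvu (norm_nonneg _))
  have h1 : 0 ≤ ⟪v, u⟫_ℝ := by
    have h : ⟪v, u⟫_ℝ = ‖v‖ ^ 2 - ⟪v, v - u⟫_ℝ := by rw [inner_sub_right v v u, real_inner_self_eq_norm_sq]; ring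
    rw [h]; nlinarith [norm_nonneg v]
  -- (2) `⟪v, u⟫² ≥ (3/4)(‖v‖‖u‖)²` from `‖v‖²‖u‖² − ⟪v,u⟫² = ‖v − u‖²‖u‖² − (‖u‖² − ⟪v,u⟫)²`
  have hid : ‖v‖ ^ 2 * ‖u‖ ^ 2 - ⟪v, u⟫_ℝ ^ 2 = ‖v - u‖ ^ 2 * ‖u‖ ^ 2 - (‖u‖ ^ 2 - ⟪v, u⟫_ℝ) ^ 2 := by
    rw [norm_sub_sq_real v u]; ring
  have h2 : 3 / 4 * (‖v‖ * ‖u‖) ^ 2 ≤ ⟪v, u⟫_ℝ ^ 2 := by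
    have hvu2 : ‖v - u‖ ^ 2 ≤ q ^ 2 := pow_le_pow_left₀ (norm_nonneg _) hvu 2
    have hq2 : 4 * q ^ 2 ≤ ‖v‖ ^ 2 := by nlinarith
    nlinarith [sq_nonneg (‖u‖ ^ 2 - ⟪v, u⟫_ℝ), mul_le_mul_of_nonneg_right hvu2 (sq_nonneg ‖u‖), sq_nonneg ‖u‖]
  -- degenerate cases
  by_cases hb0 : b = 0
  · rw [hb0, inner_zero_left]
  by_cases hv0 : v = 0
  · rw [hv0, inner_zero_right]
  have hvpos : 0 < ‖v‖ := norm_pos_iff.2 hv0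
  have hu0 : u ≠ 0 := by
    intro h
    rw [h, sub_zero] at hvu
    have : ‖v‖ ≤ 0 := by linarith
    linarith
  have hbpos : 0 < ‖b‖ := norm_pos_iff.2 hb0
  have hupos : 0 < ‖u‖ := norm_pos_iff.2 hu0
  -- the angles `α = ∠(b, u) ≥ 120°`, `β = ∠(v, u) ≤ 30°`
  have hcosα : Real.cos (angle b u) ≤ -(1 / 2) := by
    rw [cos_angle, div_le_iff₀ (mul_pos hbpos hupos)]; exact hn
  have hcosβ0 : 0 ≤ Real.cos (angle v u) := by
    rw [cos_angle]; positivity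
  have hcosβ : 3 / 4 ≤ Real.cos (angle v u) ^ 2 := by
    rw [cos_angle, div_pow, le_div_iff₀ (by positivity)]; linarith
  have hsinα : Real.sin (angle b u) ^ 2 ≤ 3 / 4 := by nlinarith [Real.sin_sq_add_cos_sq (angle b u)]
  have hsinβ : Real.sin (angle v u) ^ 2 ≤ 1 / 4 := by nlinarith [Real.sin_sq_add_cos_sq (angle v u)]
  have hβα : angle v u ≤ angle b u := by
    by_contra h
    have h' := Real.cos_le_cos_of_nonneg_of_le_pi (angle_nonneg b u) (angle_le_pi v u) (le_of_not_ge h)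
    nlinarith
  -- spherical triangle inequality at the apex: `∠(b, u) ≤ ∠(b, v) + ∠(v, u)`
  have htri : angle b u ≤ angle b v + angle v u := angle_le_angle_add_angle b v u
  have hcos1 : Real.cos (angle b v) ≤ Real.cos (angle b u - angle v u) :=
    Real.cos_le_cos_of_nonneg_of_le_pi (sub_nonneg.2 hβα) (angle_le_pi b v) (by linarith)
  have hcos2 : Real.cos (angle b u - angle v u) ≤ 0 := by
    rw [Real.cos_sub]
    have hsα0 : 0 ≤ Real.sin (angle b u) := sin_angle_nonneg b u
    have hsβ0 : 0 ≤ Real.sin (angle v u) := sin_angle_nonneg v u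
    have hX : Real.sin (angle b u) ^ 2 * Real.sin (angle v u) ^ 2 ≤ 3 / 4 * (1 / 4) :=
      mul_le_mul hsinα hsinβ (sq_nonneg _) (by norm_num)
    have hY : 1 / 4 * (3 / 4) ≤ Real.cos (angle b u) ^ 2 * Real.cos (angle v u) ^ 2 :=
      mul_le_mul (by nlinarith) hcosβ (by norm_num) (sq_nonneg _)
    have hY0 : Real.cos (angle b u) * Real.cos (angle v u) ≤ 0 :=
      mul_nonpos_iff.2 (Or.inr ⟨by linarith, hcosβ0⟩)
    nlinarith [mul_nonneg hsα0 hsβ0]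
  have key := cos_angle_mul_norm_mul_norm b v
  rw [← key]
  exact mul_nonpos_iff.2 (Or.inr ⟨hcos1.trans hcos2, by positivity⟩)

/-- ★ **THE CONE LEMMA (point form).**  `y` in the container ball `B̄(x₀, q)`, seen from `p` at distance `≥ r ≥ 2q`, lies within `30°` of the
direction `x₀ − p`; a step `n − p` at angle `≥ 120°` from `x₀ − p` is at angle `≥ 90°` from `y − p`. [this file, g80] -/
theorem inner_nonpos_of_cone {p x₀ y n : V} {q r : ℝ} (hqr : 2 * q ≤ r) (hy : dist y x₀ ≤ q) (hyp : r ≤ dist y p)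
    (hn : ⟪n - p, x₀ - p⟫_ℝ ≤ -(1 / 2) * (‖n - p‖ * ‖x₀ - p‖)) : ⟪n - p, y - p⟫_ℝ ≤ 0 := by
  refine inner_nonpos_of_cone_vec (u := x₀ - p) hqr ?_ ?_ hn
  · rw [sub_sub_sub_cancel_right, ← dist_eq_norm]; exact hy
  · rw [← dist_eq_norm]; exact hyp

/-- ★ **THE CONE LEMMA, distance form**: with `r < dist y p` the step lands at distance `> r` from `y`
(`dist n y² = ‖n − p‖² − 2⟪n − p, y − p⟫ + ‖y − p‖² > r²`). [this file, g80] -/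
theorem lt_dist_of_cone {p x₀ y n : V} {q r : ℝ} (hqr : 2 * q ≤ r) (hr : 0 ≤ r) (hy : dist y x₀ ≤ q) (hyp : r < dist y p)
    (hn : ⟪n - p, x₀ - p⟫_ℝ ≤ -(1 / 2) * (‖n - p‖ * ‖x₀ - p‖)) : r < dist n y := by
  have h := inner_nonpos_of_cone hqr hy hyp.le hn
  have hsq : dist n y ^ 2 = ‖n - p‖ ^ 2 - 2 * ⟪n - p, y - p⟫_ℝ + ‖y - p‖ ^ 2 := by
    rw [dist_eq_norm, show n - y = (n - p) - (y - p) by abel, norm_sub_sq_real]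
  rw [dist_eq_norm] at hyp
  by_contra hle
  have hle' : dist n y ≤ r := le_of_not_gt hle
  have h3 : dist n y ^ 2 ≤ r ^ 2 := pow_le_pow_left₀ dist_nonneg hle' 2
  have h4 : r ^ 2 < ‖y - p‖ ^ 2 := by nlinarith [norm_nonneg (y - p)]
  nlinarith [sq_nonneg ‖n - p‖]

end Cone

/-! ### §2  Covering radius `45°` of the fcc and hcp kissing patterns -/

/-- the two coordinates other than `k`. -/
def others : Fin 3 → Fin 3 × Fin 3 := ![(1, 2), (0, 2), (0, 1)]

/-- the integer vector with `0` at coordinate `k` and `a`, `b` at the other two. -/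
def selVec (k : Fin 3) (a b : ℤ) : Fin 3 → ℤ := fun i => if i = k then 0 else if i = (others k).1 then a else b

/-- the lower-cap vector `3·selVec k 1 1 − (4,4,4)` of the hcp model (mirror image of the upper-cap vector `3·selVec k 1 1`). -/
def capVec (k : Fin 3) : Fin 3 → ℤ := fun i => 3 * selVec k 1 1 i - 4

/-- `3 • selVec`. -/
def selVec3 (k : Fin 3) (a b : ℤ) : Fin 3 → ℤ := fun i => 3 * selVec k a b i

/-- the two signs. -/
def signs : Finset ℤ := {1, -1}

/-- the `12` sign vectors are the fcc first-shell integer model `fccInt`. [decide] -/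
theorem selVec_mem_fccInt : ∀ k : Fin 3, ∀ a ∈ signs, ∀ b ∈ signs, selVec k a b ∈ fccInt := by decide

/-- `3 •` a sign vector with not both signs negative lies in the hcp model `hcpInt` (hexagon ∪ upper cap). [decide] -/
theorem selVec3_mem_hcpInt : ∀ k : Fin 3, ∀ a ∈ signs, ∀ b ∈ signs, ¬ (a = -1 ∧ b = -1) → selVec3 k a b ∈ hcpInt := by decide

/-- the three lower-cap vectors lie in `hcpInt`. [decide] -/
theorem capVec_mem_hcpInt : ∀ k : Fin 3, capVec k ∈ hcpInt := by decide

/-- inner product with an integer vector, in coordinates. -/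
theorem inner_intVec (z : Fin 3 → ℤ) (w : E3) : ⟪intVec z, w⟫_ℝ = z 0 * w 0 + z 1 * w 1 + z 2 * w 2 := by
  rw [PiLp.inner_apply]
  simp only [Fin.sum_univ_three, intVec_apply, RCLike.inner_apply, conj_trivial]
  ring

/-- `‖w‖² = w₀² + w₁² + w₂²` on `E3`. [Mathlib `EuclideanSpace.real_norm_sq_eq`] -/
private theorem norm_sq_coords (w : E3) : ‖w‖ ^ 2 = w 0 ^ 2 + w 1 ^ 2 + w 2 ^ 2 := by
  rw [EuclideanSpace.real_norm_sq_eq, Fin.sum_univ_three]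

/-- `⟪selVec k a b, w⟫ = a·w_i + b·w_j` (`(i, j) = others k`). [formal bookkeeping] -/
theorem inner_selVec (k : Fin 3) (a b : ℤ) (w : E3) : ⟪intVec (selVec k a b), w⟫_ℝ = a * w (others k).1 + b * w (others k).2 := by
  rw [inner_intVec]
  fin_cases k <;> simp [selVec, others]

/-- `⟪3•selVec k a b, w⟫ = 3(a·w_i + b·w_j)`. [formal bookkeeping] -/
theorem inner_selVec3 (k : Fin 3) (a b : ℤ) (w : E3) : ⟪intVec (selVec3 k a b), w⟫_ℝ = 3 * (a * w (others k).1 + b * w (others k).2) := by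
  rw [inner_intVec]
  fin_cases k <;> simp [selVec3, selVec, others] <;> ring

/-- `⟪capVec k, w⟫ = 3(w_i + w_j) − 4·Σ w`. [formal bookkeeping] -/
theorem inner_capVec (k : Fin 3) (w : E3) :
    ⟪intVec (capVec k), w⟫_ℝ = 3 * (w (others k).1 + w (others k).2) - 4 * (w 0 + w 1 + w 2) := by
  rw [inner_intVec]
  fin_cases k <;> simp [capVec, selVec, others] <;> ring

/-- `‖w‖² = w_k² + w_i² + w_j²`. [formal bookkeeping] -/
theorem norm_sq_others (k : Fin 3) (w : E3) : ‖w‖ ^ 2 = w k ^ 2 + w (others k).1 ^ 2 + w (others k).2 ^ 2 := by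
  rw [norm_sq_coords]
  fin_cases k <;> simp [others] <;> ring

/-- `Σ w = w_k + w_i + w_j`. [formal bookkeeping] -/
theorem sum_others (k : Fin 3) (w : E3) : w 0 + w 1 + w 2 = w k + w (others k).1 + w (others k).2 := by
  fin_cases k <;> simp [others] <;> ring

/-- the sign of a real as `±1 : ℤ` (`+1` at `0`). -/
def sgnZ (x : ℝ) : ℤ := if 0 ≤ x then 1 else -1

/-- `sgnZ x ∈ {1, −1}`. [formal bookkeeping] -/
theorem sgnZ_mem (x : ℝ) : sgnZ x ∈ signs := by
  unfold sgnZ signs; split_ifs <;> simp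

/-- `sgnZ x · x = |x|`. [formal bookkeeping] -/
theorem sgnZ_mul (x : ℝ) : (sgnZ x : ℝ) * x = |x| := by
  unfold sgnZ; split_ifs with h
  · push_cast; rw [abs_of_nonneg h]; ring
  · push_cast; rw [abs_of_neg (lt_of_not_ge h)]; ring

/-- `sgnZ x = −1 → x < 0`. [formal bookkeeping] -/
theorem neg_of_sgnZ {x : ℝ} (h : sgnZ x = -1) : x < 0 := by
  by_contra hx
  rw [not_lt] at hx
  simp [sgnZ, hx] at h

/-- a coordinate of least square. -/
theorem exists_min_coord (w : E3) : ∃ k : Fin 3, ∀ i, w k ^ 2 ≤ w i ^ 2 := by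
  obtain ⟨k, -, hk⟩ := Finset.exists_min_image Finset.univ (fun i => w i ^ 2) Finset.univ_nonempty
  exact ⟨k, fun i => hk i (Finset.mem_univ i)⟩

/-- the two largest `|coordinates|` dominate the norm: `‖w‖ ≤ |w i| + |w j|` when `w k² ≤ w i², w j²`. -/
theorem norm_le_abs_add_abs {w : E3} {k : Fin 3} (hk : ∀ i, w k ^ 2 ≤ w i ^ 2) :
    ‖w‖ ≤ |w (others k).1| + |w (others k).2| := by
  have hN := norm_sq_others k w
  have hzx : w k ^ 2 ≤ w (others k).1 ^ 2 := hk _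
  have hzy : w k ^ 2 ≤ w (others k).2 ^ 2 := hk _
  have h4 : (w k ^ 2) ^ 2 ≤ (|w (others k).1| * |w (others k).2|) ^ 2 := by
    rw [mul_pow, sq_abs, sq_abs]; exact (sq _).le.trans (mul_le_mul hzx hzy (sq_nonneg _) (sq_nonneg _))
  have h5 : w k ^ 2 ≤ |w (others k).1| * |w (others k).2| :=
    (pow_le_pow_iff_left₀ (sq_nonneg _) (by positivity) two_ne_zero).1 h4
  have h6 : ‖w‖ ^ 2 ≤ (|w (others k).1| + |w (others k).2|) ^ 2 := by
    rw [hN, add_sq, sq_abs, sq_abs]; nlinarith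
  exact (pow_le_pow_iff_left₀ (norm_nonneg _) (by positivity) two_ne_zero).1 h6

/-- **fcc selection**: some first-shell integer vector `z ∈ fccInt` (`‖z‖ = √2`) has `⟪z, w⟫ ≥ ‖w‖` (angle `≤ 45°`). [this file, g80] -/
theorem exists_fccInt_toward (w : E3) : ∃ z ∈ fccInt, ‖w‖ ≤ ⟪intVec z, w⟫_ℝ := by
  obtain ⟨k, hk⟩ := exists_min_coord w
  refine ⟨selVec k (sgnZ (w (others k).1)) (sgnZ (w (others k).2)), selVec_mem_fccInt k _ (sgnZ_mem _) _ (sgnZ_mem _), ?_⟩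
  rw [inner_selVec, sgnZ_mul, sgnZ_mul]
  exact norm_le_abs_add_abs hk

/-- the selection is never "both signs negative" on a vector with `Σ w ≥ 0`. -/
theorem not_both_neg {w : E3} {k : Fin 3} (hk : ∀ i, w k ^ 2 ≤ w i ^ 2) (hs : 0 ≤ w 0 + w 1 + w 2) :
    ¬ (sgnZ (w (others k).1) = -1 ∧ sgnZ (w (others k).2) = -1) := by
  rintro ⟨h₁, h₂⟩
  have hx := neg_of_sgnZ h₁
  have hy := neg_of_sgnZ h₂
  have hzx : w k ^ 2 ≤ w (others k).1 ^ 2 := hk _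
  rw [sum_others k] at hs
  -- `|w k| ≤ |w i|` with `w i < 0` gives `w k ≤ -w i`
  nlinarith

/-- the mirror through the hexagonal plane `{Σ w = 0}`: `w ↦ w − (2/3)(Σ w)·(1,1,1)`. -/
def mirror (w : E3) : E3 := w - ((2 / 3) * (w 0 + w 1 + w 2)) • intVec (fun _ => 1)

/-- coordinates of the mirror image. [formal bookkeeping] -/
theorem mirror_apply (w : E3) (i : Fin 3) : mirror w i = w i - (2 / 3) * (w 0 + w 1 + w 2) := by
  simp [mirror]

/-- the mirror negates `Σ w`. [formal bookkeeping] -/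
theorem mirror_sum (w : E3) : mirror w 0 + mirror w 1 + mirror w 2 = -(w 0 + w 1 + w 2) := by
  simp only [mirror_apply]; ring

/-- the mirror is norm-preserving (it is the reflection in the plane `Σ w = 0`). [formal bookkeeping] -/
theorem norm_mirror (w : E3) : ‖mirror w‖ = ‖w‖ := by
  have h : ‖mirror w‖ ^ 2 = ‖w‖ ^ 2 := by
    rw [norm_sq_coords, norm_sq_coords, mirror_apply, mirror_apply, mirror_apply]; ring
  exact (sq_eq_sq₀ (norm_nonneg _) (norm_nonneg _)).1 h

/-- **hcp selection**: some first-shell integer vector `z ∈ hcpInt` (`‖z‖ = 3√2`) has `⟪z, w⟫ ≥ 3‖w‖` (angle `≤ 45°`). [this file, g80] -/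
theorem exists_hcpInt_toward (w : E3) : ∃ z ∈ hcpInt, 3 * ‖w‖ ≤ ⟪intVec z, w⟫_ℝ := by
  by_cases hs : 0 ≤ w 0 + w 1 + w 2
  · obtain ⟨k, hk⟩ := exists_min_coord w
    refine ⟨selVec3 k (sgnZ (w (others k).1)) (sgnZ (w (others k).2)),
      selVec3_mem_hcpInt k _ (sgnZ_mem _) _ (sgnZ_mem _) (not_both_neg hk hs), ?_⟩
    rw [inner_selVec3, sgnZ_mul, sgnZ_mul]
    linarith [norm_le_abs_add_abs hk]
  · -- mirrored selection
    set w' := mirror w with hw'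
    have hs' : 0 ≤ w' 0 + w' 1 + w' 2 := by rw [hw', mirror_sum]; linarith
    obtain ⟨k, hk⟩ := exists_min_coord w'
    have hnb := not_both_neg hk hs'
    have hle : ‖w‖ ≤ |w' (others k).1| + |w' (others k).2| := by
      have h := norm_le_abs_add_abs hk
      rwa [hw', norm_mirror, ← hw'] at h
    obtain ⟨a, ha⟩ : ∃ a, a = sgnZ (w' (others k).1) := ⟨_, rfl⟩
    obtain ⟨b, hb⟩ : ∃ b, b = sgnZ (w' (others k).2) := ⟨_, rfl⟩
    rw [← ha, ← hb] at hnb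
    have ha' : (a : ℝ) * w' (others k).1 = |w' (others k).1| := by rw [ha]; exact sgnZ_mul _
    have hb' : (b : ℝ) * w' (others k).2 = |w' (others k).2| := by rw [hb]; exact sgnZ_mul _
    have h1 : w' (others k).1 = w (others k).1 - (2 / 3) * (w 0 + w 1 + w 2) := mirror_apply w _
    have h2 : w' (others k).2 = w (others k).2 - (2 / 3) * (w 0 + w 1 + w 2) := mirror_apply w _
    have hamem : a ∈ signs := by rw [ha]; exact sgnZ_mem _
    have hbmem : b ∈ signs := by rw [hb]; exact sgnZ_mem _
    by_cases hab : a = 1 ∧ b = 1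
    · -- lower cap
      refine ⟨capVec k, capVec_mem_hcpInt k, ?_⟩
      rw [inner_capVec]
      obtain ⟨ha1, hb1⟩ := hab
      rw [ha1] at ha'; rw [hb1] at hb'
      push_cast at ha' hb'
      linarith
    · -- hexagon: `a + b = 0`
      have hsum : (a : ℝ) + b = 0 := by
        simp only [signs, Finset.mem_insert, Finset.mem_singleton] at hamem hbmem
        rcases hamem with h | h <;> rcases hbmem with h' | h'
        · exact absurd ⟨h, h'⟩ hab
        · rw [h, h']; norm_num
        · rw [h, h']; norm_num
        · exact absurd ⟨h, h'⟩ hnb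
      refine ⟨selVec3 k a b, selVec3_mem_hcpInt k a hamem b hbmem hnb, ?_⟩
      rw [inner_selVec3]
      have hkey : (a : ℝ) * w (others k).1 + b * w (others k).2 = a * w' (others k).1 + b * w' (others k).2 := by
        rw [h1, h2]; linear_combination ((2 : ℝ) / 3 * (w 0 + w 1 + w 2)) * hsum
      rw [hkey, ha', hb']
      linarith

/-- `√18 = 3√2`. [formal bookkeeping] -/
private theorem sqrt_eighteen : Real.sqrt 18 = 3 * Real.sqrt 2 := by
  rw [show (18 : ℝ) = 3 ^ 2 * 2 by norm_num, Real.sqrt_mul (by norm_num), Real.sqrt_sq (by norm_num)]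

/-- ★ **COVERING RADIUS `45°`**: for either two-shell pattern `P` and any `w`, some first-shell `v ∈ P` (`‖v‖ = 1`) has `‖w‖ ≤ √2·⟪v, w⟫`.
[this file, g80] -/
theorem exists_kissing_toward {P : Finset E3} (hP : P = fccTwoShellPattern ∨ P = hcpTwoShellPattern) (w : E3) :
    ∃ v ∈ P, ‖v‖ = 1 ∧ ‖w‖ ≤ Real.sqrt 2 * ⟪v, w⟫_ℝ := by
  have hs2 : 0 < Real.sqrt 2 := Real.sqrt_pos.2 (by norm_num)
  rcases hP with rfl | rfl
  · obtain ⟨z, hz, hzw⟩ := exists_fccInt_toward w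
    have hmem : (Real.sqrt (2 : ℕ))⁻¹ • intVec z ∈ fccKissingPattern := Finset.mem_image_of_mem _ hz
    refine ⟨_, fccKissingPattern_subset hmem, norm_eq_one_of_mem_fccKissingPattern hmem, ?_⟩
    rw [real_inner_smul_left, Nat.cast_ofNat, ← mul_assoc, mul_inv_cancel₀ hs2.ne', one_mul]
    exact hzw
  · obtain ⟨z, hz, hzw⟩ := exists_hcpInt_toward w
    have hmem : (Real.sqrt (18 : ℕ))⁻¹ • intVec z ∈ hcpKissingPattern := Finset.mem_image_of_mem _ hz
    refine ⟨_, hcpKissingPattern_subset hmem, norm_eq_one_of_mem_hcpKissingPattern hmem, ?_⟩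
    have hs2' : Real.sqrt 2 ≠ 0 := hs2.ne'
    have h18 : Real.sqrt 2 * (Real.sqrt (18 : ℕ))⁻¹ = 1 / 3 := by
      rw [Nat.cast_ofNat, sqrt_eighteen]; field_simp
    rw [real_inner_smul_left, ← mul_assoc, h18]
    linarith


end Summit.AtomisticToContinuum.Crystallization.Theorems.ChartedZeroExcessLayeredLatticeLiouville

end
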